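import Literature.Geometry.Lorentzian.KerrConvergenceProofs
import Literature.Geometry.Lorentzian.TimeCones
import Literature.Geometry.Lorentzian.ExtensionProofs
import Summits.FinalStateConjecture.FinalStateConjecture.Theorems.EIHFluxBalanceInertialRecessionLorentz

/-!
# Anchor-shell algebra for `FutureOrientedOfSeamed` (load-bearing analysis of SEAMED (5), part 1/2;
# crux `stmt-FinalStateConjecture-17576`, route `StarvedNecks`)

Pointwise Lorentz / Kerr–Schild algebra and chart calculus used by `Seamed5FromOneAtlas.lean` to show that
SEAMED (5) (future-directed hole time-lines on the certified tubes) is NOT a load-bearing hypothesis of the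
crux `FutureOrientedOfSeamed`: for an orthochronous Lorentz transformation `Λ` and a Kerr–Schild point with
`2H ≤ 1/50` (i.e. beyond `r ≥ 100M`),

* `(Λ⁻¹e₀)⁰ = (Λe₀)⁰ ≥ 1`, `|Λ⁻¹e₀ (spatial)|² = ((Λe₀)⁰)² − 1`, `‖Λ‖ ≥ (Λe₀)⁰` (`lorentz_symm_apply_basisVector_zero` of
  `EIHFluxBalanceInertialRecessionLorentz.lean`, `spatial_sq_symm_basisVector_zero`, `one_le_basisVector_zero`, `basisVector_zero_le_opNorm`);
* `ℓ₁² + ℓ₂² + ℓ₃² = 1` for the Kerr–Schild null covector and hence `ℓ(Λ⁻¹e₀) < 2(Λe₀)⁰`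
  (`nullCovectorFun_spatial_sq`, `nullCovector_symm_basisVector_zero_lt`, Cauchy–Schwarz);
* `H ≤ M/r` and the two pairings `g_{M,a}(e₀, e₀) ≤ −1 + 1/50`, `g_{M,a}(e₀, Λ⁻¹e₀) ≤ −(24/25)(Λe₀)⁰`
  (`scalarH_le_div`, `kerr_pairings`) — BOOST-INDEPENDENT;
* pointwise conversions: `C⁰` extraction from `supCkENorm` (`norm_deviation_le_of_supCkENorm_le`), deviation
  bound ⇒ timelike push-forward (`isTimelike_mfderiv_of_norm_deviation_le`, the lever-kit lemma A3 of the crux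
  ideation), negative pairing with a future-directed CAUSAL anchor ⇒ future-directed
  (`isFutureDirected_mfderiv_of_pairing_neg`, via `IsFutureDirected.val_nonpos`; no timelikeness of the anchor),
  transport along an equality of base points (`isFutureDirected_congr_point`), and locality of `mfderiv` across
  two open subtypes (`mfderiv_eq_of_eqOn_isOpen`).

No route item is asserted; everything is `sorry`-free.

References: B. O'Neill, *Semi-Riemannian geometry*, Academic Press 1983, Ch. 5, Lemma 5.29 and Ch. 9, p. 233
(Lorentz group); R. P. Kerr, A. Schild (1965), §3; M. Visser, arXiv:0706.0622, (32)–(35); J. M. Lee,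
*Introduction to Smooth Manifolds* (2013), Prop. 3.9.
-/

open TopologicalSpace Manifold Filter Topology Set Function
open scoped ContDiff Topology Manifold ENNReal

noncomputable section

-- `<Problem> = <Summit>` doubles the namespace component (tree-wide convention, cf. lakefile)
set_option linter.dupNamespace false
-- instance search through nested operator types `E4 →L E4 →L ℝ` (as in the tree files)
set_option maxSynthPendingDepth 3

namespace Summit.FinalStateConjecture.FinalStateConjecture.Theorems.FutureOrientedOfSeamed.Negative

open Literature.Geometry.Lorentzian LorentzianMetric

/-- `η(Λ⁻¹e₀, Λ⁻¹e₀) = −1`. [folklore] -/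
theorem bilin_symm_basisVector_zero (Λ : lorentzGroup) :
    Minkowski.bilin ((Λ : E4 ≃L[ℝ] E4).symm (E4.basisVector 0)) ((Λ : E4 ≃L[ℝ] E4).symm (E4.basisVector 0)) = -1 := by
  have h := Λ.2 ((Λ : E4 ≃L[ℝ] E4).symm (E4.basisVector 0)) ((Λ : E4 ≃L[ℝ] E4).symm (E4.basisVector 0))
  rw [ContinuousLinearEquiv.apply_symm_apply, Minkowski.bilin_basisVector_zero] at h
  exact h.symm

/-- Spatial part of the unit timelike vector `w = Λ⁻¹e₀`: `w₁² + w₂² + w₃² = (w⁰)² − 1`. [folklore] -/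
theorem spatial_sq_symm_basisVector_zero (Λ : lorentzGroup) :
    ((Λ : E4 ≃L[ℝ] E4).symm (E4.basisVector 0)) 1 ^ 2 + ((Λ : E4 ≃L[ℝ] E4).symm (E4.basisVector 0)) 2 ^ 2 +
      ((Λ : E4 ≃L[ℝ] E4).symm (E4.basisVector 0)) 3 ^ 2 = ((Λ : E4 ≃L[ℝ] E4).symm (E4.basisVector 0)) 0 ^ 2 - 1 := by
  have h := bilin_symm_basisVector_zero Λ
  rw [Minkowski.bilin_apply, Fin.sum_univ_three] at h
  simp only [Fin.succ_zero_eq_one, Fin.succ_one_eq_two] at h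
  have h3 : (2 : Fin 3).succ = (3 : Fin 4) := rfl
  rw [h3] at h
  nlinarith [h]

/-- The spatial components of the Kerr–Schild null covector form a unit vector: `ℓ₁² + ℓ₂² + ℓ₃² = 1`
wherever `r > 0` (`ℓ(ℓ♯) = 0`, `ℓ₀ = 1`). [folklore] -/
theorem nullCovectorFun_spatial_sq {a : ℝ} {z : E4} (hz : 0 < Kerr.radius a z) :
    Kerr.nullCovectorFun a z 1 ^ 2 + Kerr.nullCovectorFun a z 2 ^ 2 + Kerr.nullCovectorFun a z 3 ^ 2 = 1 := by
  have h := Kerr.nullCovector_nullVector hz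
  have h0 : Kerr.nullCovectorFun a z 0 = 1 := rfl
  simp only [Kerr.nullCovector, Kerr.nullVector, E4.covector_apply, Fin.sum_univ_four, Fin.isValue,
    if_true, one_ne_zero, if_false, Fin.reduceEq, h0] at h
  nlinarith [h]

/-- `ℓ(w) < 2 w⁰` for the unit future timelike `w = Λ⁻¹e₀` of an orthochronous `Λ` (Cauchy–Schwarz on the
spatial parts, `|ℓ̄| = 1`, `|w̄|² = (w⁰)² − 1`). [folklore] -/
theorem nullCovector_symm_basisVector_zero_lt {a : ℝ} {z : E4} (hz : 0 < Kerr.radius a z) (Λ : lorentzGroup)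
    (hΛ : 0 < ((Λ : E4 ≃L[ℝ] E4) (E4.basisVector 0)) 0) :
    Kerr.nullCovector a z ((Λ : E4 ≃L[ℝ] E4).symm (E4.basisVector 0)) < 2 * ((Λ : E4 ≃L[ℝ] E4) (E4.basisVector 0)) 0 := by
  set w := (Λ : E4 ≃L[ℝ] E4).symm (E4.basisVector 0) with hw
  have hw0 : w 0 = ((Λ : E4 ≃L[ℝ] E4) (E4.basisVector 0)) 0 := lorentz_symm_apply_basisVector_zero Λ
  have hsp := spatial_sq_symm_basisVector_zero Λ
  rw [← hw] at hsp
  have hl := nullCovectorFun_spatial_sq hz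
  set l := Kerr.nullCovectorFun a z with hl_def
  have happ : Kerr.nullCovector a z w = w 0 + (l 1 * w 1 + l 2 * w 2 + l 3 * w 3) := by
    have h0 : l 0 = 1 := rfl
    simp only [Kerr.nullCovector, E4.covector_apply, Fin.sum_univ_four, ← hl_def, h0]
    ring
  -- Cauchy–Schwarz in dimension three
  have hcs : (l 1 * w 1 + l 2 * w 2 + l 3 * w 3) ^ 2 ≤
      (l 1 ^ 2 + l 2 ^ 2 + l 3 ^ 2) * (w 1 ^ 2 + w 2 ^ 2 + w 3 ^ 2) := by
    nlinarith [sq_nonneg (l 1 * w 2 - l 2 * w 1), sq_nonneg (l 1 * w 3 - l 3 * w 1),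
      sq_nonneg (l 2 * w 3 - l 3 * w 2)]
  rw [hl, one_mul, hsp] at hcs
  have hlt : (l 1 * w 1 + l 2 * w 2 + l 3 * w 3) ^ 2 < w 0 ^ 2 := by linarith
  have habs := abs_lt_of_sq_lt_sq hlt (by rw [hw0]; exact hΛ.le)
  rw [happ, hw0]
  have := (abs_lt.mp habs).2
  rw [hw0] at this
  linarith

/-- `H ≤ M / r` for `M ≥ 0`, `r > 0` (`H = M r³/(r⁴ + a²z²)`). [folklore] -/
theorem scalarH_le_div {M a : ℝ} (hM : 0 ≤ M) {z : E4} (hz : 0 < Kerr.radius a z) :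
    Kerr.scalarH M a z ≤ M / Kerr.radius a z := by
  unfold Kerr.scalarH
  set r := Kerr.radius a z
  rw [div_le_div_iff₀ (by positivity) hz]
  nlinarith [mul_nonneg hM (mul_nonneg (sq_nonneg a) (sq_nonneg (z 3))), pow_pos hz 3]

/-- Kerr–Schild pairings at a point with `2H ≤ 1/50` against the rest-frame clock vector `e₀` and the lab clock
vector `w = Λ⁻¹e₀` of an orthochronous `Λ`: `g(e₀, e₀) ≤ −1 + 1/50` and `g(e₀, w) ≤ −(24/25) w⁰`. [folklore] -/
theorem kerr_pairings {M a : ℝ} (hM : 0 ≤ M) {z : E4} (hz : 0 < Kerr.radius a z)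
    (hH : 2 * Kerr.scalarH M a z ≤ 1 / 50) (Λ : lorentzGroup) (hΛ : 0 < ((Λ : E4 ≃L[ℝ] E4) (E4.basisVector 0)) 0) :
    Kerr.bilin M a z (E4.basisVector 0) (E4.basisVector 0) ≤ -1 + 1 / 50 ∧
      Kerr.bilin M a z (E4.basisVector 0) ((Λ : E4 ≃L[ℝ] E4).symm (E4.basisVector 0)) ≤ -(24 / 25) * ((Λ : E4 ≃L[ℝ] E4) (E4.basisVector 0)) 0 := by
  have hH0 : 0 ≤ Kerr.scalarH M a z := Kerr.scalarH_nonneg hM a z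
  constructor
  · rw [Kerr.bilin_apply, Kerr.nullCovector_basisVector_zero, Minkowski.bilin_basisVector_zero]
    linarith
  · have hlt := nullCovector_symm_basisVector_zero_lt hz Λ hΛ
    have hw0 := lorentz_symm_apply_basisVector_zero Λ
    rw [Kerr.bilin_apply, Kerr.nullCovector_basisVector_zero, Minkowski.bilin_basisVector_zero_left, hw0, one_mul]
    set γ := ((Λ : E4 ≃L[ℝ] E4) (E4.basisVector 0)) 0
    set L := Kerr.nullCovector a z ((Λ : E4 ≃L[ℝ] E4).symm (E4.basisVector 0))
    by_cases hL : 0 ≤ L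
    · nlinarith [mul_le_mul_of_nonneg_right hH hL]
    · push Not at hL
      nlinarith [mul_nonneg hH0 hΛ.le, mul_neg_of_pos_of_neg (show (0:ℝ) < 2 by norm_num) hL]

/-- `(Λe₀)⁰ ≥ 1` for an orthochronous Lorentz transformation. [folklore] -/
theorem one_le_basisVector_zero (Λ : lorentzGroup) (hΛ : 0 < ((Λ : E4 ≃L[ℝ] E4) (E4.basisVector 0)) 0) :
    1 ≤ ((Λ : E4 ≃L[ℝ] E4) (E4.basisVector 0)) 0 := by
  have hsp := spatial_sq_symm_basisVector_zero Λ
  rw [lorentz_symm_apply_basisVector_zero Λ] at hsp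
  nlinarith [sq_nonneg (((Λ : E4 ≃L[ℝ] E4).symm (E4.basisVector 0)) 1), sq_nonneg (((Λ : E4 ≃L[ℝ] E4).symm (E4.basisVector 0)) 2),
    sq_nonneg (((Λ : E4 ≃L[ℝ] E4).symm (E4.basisVector 0)) 3)]

/-- `‖Λ‖ ≥ (Λe₀)⁰` (operator norm ≥ a component of the image of the unit vector `e₀`). [folklore] -/
theorem basisVector_zero_le_opNorm (Λ : lorentzGroup) :
    ((Λ : E4 ≃L[ℝ] E4) (E4.basisVector 0)) 0 ≤ ‖((Λ : E4 ≃L[ℝ] E4) : E4 →L[ℝ] E4)‖ := by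
  have h1 : ((Λ : E4 ≃L[ℝ] E4) (E4.basisVector 0)) 0 ≤ ‖(Λ : E4 ≃L[ℝ] E4) (E4.basisVector 0)‖ :=
    (le_abs_self _).trans ((Real.norm_eq_abs _).symm.le.trans (PiLp.norm_apply_le _ 0))
  have h2 : ‖(Λ : E4 ≃L[ℝ] E4) (E4.basisVector 0)‖ ≤ ‖((Λ : E4 ≃L[ℝ] E4) : E4 →L[ℝ] E4)‖ * ‖(E4.basisVector 0 : E4)‖ :=
    ((Λ : E4 ≃L[ℝ] E4) : E4 →L[ℝ] E4).le_opNorm (E4.basisVector 0)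
  rw [C0Extension.norm_basisVector_zero, mul_one] at h2
  exact h1.trans h2


/-! ### Locality of `mfderiv` across two open subtypes -/

section Locality
variable {E : Type*} [NormedAddCommGroup E] [NormedSpace ℝ E] {H : Type*} [TopologicalSpace H]
  {I : ModelWithCorners ℝ E H} {M : Type*} [TopologicalSpace M] [ChartedSpace H M]
  {F : Type*} [NormedAddCommGroup F] [NormedSpace ℝ F]

/-- **Locality of `mfderiv` across two open subtypes**: two maps from two open subsets of a normed space into
a manifold which agree on an open set `A` have the same differential at every point of `A` (junk-extend both
to the ambient space, `mfderiv_comp_subtypeVal'`, then `Filter.EventuallyEq.mfderiv_eq`). Lee 2013,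
Prop. 3.9. [folklore] -/
theorem mfderiv_eq_of_eqOn_isOpen {U₁ U₂ : Opens F} (Ψ : U₁ → M) (Φ : U₂ → M) {A : Set F}
    (hA : IsOpen A) (h₁ : A ⊆ U₁) (h₂ : A ⊆ U₂)
    (heq : ∀ z (hz : z ∈ A), Ψ ⟨z, h₁ hz⟩ = Φ ⟨z, h₂ hz⟩) {y : F} (hy : y ∈ A) :
    mfderiv 𝓘(ℝ, F) I Ψ ⟨y, h₁ hy⟩ = mfderiv 𝓘(ℝ, F) I Φ ⟨y, h₂ hy⟩ := by
  classical
  set Ψ' : F → M := fun z ↦ if hz : z ∈ U₁ then Ψ ⟨z, hz⟩ else Ψ ⟨y, h₁ hy⟩ with hΨ'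
  set Φ' : F → M := fun z ↦ if hz : z ∈ U₂ then Φ ⟨z, hz⟩ else Φ ⟨y, h₂ hy⟩ with hΦ'
  have e₁ : Ψ = Ψ' ∘ Subtype.val := by
    funext z; simp [hΨ', z.2]
  have e₂ : Φ = Φ' ∘ Subtype.val := by
    funext z; simp [hΦ', z.2]
  have hloc : Ψ' =ᶠ[𝓝 y] Φ' := by
    filter_upwards [hA.mem_nhds hy] with z hz
    have hz₁ : z ∈ U₁ := h₁ hz
    have hz₂ : z ∈ U₂ := h₂ hz
    simp only [hΨ', hΦ', hz₁, hz₂, dif_pos]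
    exact heq z hz
  rw [e₁, e₂, mfderiv_comp_subtypeVal', mfderiv_comp_subtypeVal']
  exact hloc.mfderiv_eq

end Locality

/-! ### Pointwise conversions -/

/-- **Pointwise extraction of the `C⁰` bound** from a `supCkENorm` estimate: `supCkENorm (val '' S) 0 f ≤ δ`
gives `‖(Ψ^*g − g₀)(x)‖ ≤ δ` at every `x ∈ S` (order-`0` term of the sup norm; Bartnik 1986, (1.3)). [folklore] -/
theorem norm_deviation_le_of_supCkENorm_le {𝓢 : Spacetime.{0} 4} (B : ModelBackground)
    (Ψ : B.domain → 𝓢.carrier) {S : Set B.domain} {δ : ℝ} (hδ : 0 ≤ δ)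
    (h : supCkENorm (Subtype.val '' S) 0 (𝓢.deviationExtend B Ψ) ≤ ENNReal.ofReal δ) {x : B.domain}
    (hx : x ∈ S) : ‖𝓢.deviation B Ψ x‖ ≤ δ := by
  have h1 := (enorm_iteratedFDeriv_le_supCkENorm (le_refl 0) (mem_image_of_mem Subtype.val hx)
    (𝓢.deviationExtend B Ψ)).trans h
  rw [← ofReal_norm, norm_iteratedFDeriv_zero, 𝓢.deviationExtend_coe B Ψ x,
    ENNReal.ofReal_le_ofReal_iff hδ] at h1
  exact h1

/-- **Pointwise timelikeness from the `C⁰` deviation** (ideator 1, lever kit A3, verbatim):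
`g(dΨ W, dΨ W) = g₀(z)(W, W) + (Ψ^*g − g₀)(z)(W, W) ≤ −m + ε‖W‖² < 0`. [folklore] -/
theorem isTimelike_mfderiv_of_norm_deviation_le {𝓢 : Spacetime.{0} 4} (B : ModelBackground)
    (Ψ : B.domain → 𝓢.carrier) (z : B.domain) (W : E4) {m ε : ℝ}
    (hB : B.bilin (z : E4) W W ≤ -m) (hdev : ‖𝓢.deviation B Ψ z‖ ≤ ε) (h : ε * ‖W‖ ^ 2 < m) :
    𝓢.metric.IsTimelike (mfderiv 𝓘(ℝ, E4) (𝓡 4) Ψ z W) := by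
  have happ := 𝓢.deviation_apply B Ψ z W W
  have h1 : 𝓢.deviation B Ψ z W W ≤ ‖𝓢.deviation B Ψ z‖ * ‖W‖ * ‖W‖ := by
    have h0 : ‖𝓢.deviation B Ψ z W W‖ ≤ ‖𝓢.deviation B Ψ z‖ * ‖W‖ * ‖W‖ :=
      ((𝓢.deviation B Ψ z W).le_opNorm W).trans
        (mul_le_mul_of_nonneg_right ((𝓢.deviation B Ψ z).le_opNorm W) (norm_nonneg W))
    exact (Real.le_norm_self _).trans h0
  have h2 : ‖𝓢.deviation B Ψ z‖ * ‖W‖ * ‖W‖ ≤ ε * ‖W‖ ^ 2 := by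
    rw [mul_assoc, ← sq]
    exact mul_le_mul_of_nonneg_right hdev (sq_nonneg _)
  show 𝓢.metric.val (Ψ z) (mfderiv 𝓘(ℝ, E4) (𝓡 4) Ψ z W) (mfderiv 𝓘(ℝ, E4) (𝓡 4) Ψ z W) < 0
  linarith

/-- **Pointwise same-cone conversion without timelikeness of the anchor**: if `dΨ A` is future-directed
(causal), `dΨ W` is causal and `g₀(z)(A, W) + ‖(Ψ^*g − g₀)(z)‖ ‖A‖ ‖W‖ < 0`, then `dΨ W` is future-directed —
otherwise `−dΨ W` would be future-directed and pair nonpositively with `dΨ A` (`IsFutureDirected.val_nonpos`).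
O'Neill 1983, Ch. 5, Lemma 5.29. [folklore] -/
theorem isFutureDirected_mfderiv_of_pairing_neg {𝓢 : Spacetime.{0} 4} (B : ModelBackground)
    (Ψ : B.domain → 𝓢.carrier) (z : B.domain) (A W : E4)
    (hA : 𝓢.timeOrientation.IsFutureDirected (mfderiv 𝓘(ℝ, E4) (𝓡 4) Ψ z A))
    (hW : 𝓢.metric.IsCausal (mfderiv 𝓘(ℝ, E4) (𝓡 4) Ψ z W))
    (hneg : B.bilin (z : E4) A W + ‖𝓢.deviation B Ψ z‖ * ‖A‖ * ‖W‖ < 0) :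
    𝓢.timeOrientation.IsFutureDirected (mfderiv 𝓘(ℝ, E4) (𝓡 4) Ψ z W) := by
  have happ := 𝓢.deviation_apply B Ψ z A W
  have hle : 𝓢.deviation B Ψ z A W ≤ ‖𝓢.deviation B Ψ z‖ * ‖A‖ * ‖W‖ :=
    (Real.le_norm_self _).trans (ContinuousLinearMap.le_opNorm₂ _ _ _)
  have hpair : 𝓢.metric.val (Ψ z) (mfderiv 𝓘(ℝ, E4) (𝓡 4) Ψ z A) (mfderiv 𝓘(ℝ, E4) (𝓡 4) Ψ z W) < 0 := by
    linarith
  rcases 𝓢.timeOrientation.isFutureDirected_or_isPastDirected_of_isCausal hW with hF | hP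
  · exact hF
  · exfalso
    have hnegF : 𝓢.timeOrientation.IsFutureDirected (-(mfderiv 𝓘(ℝ, E4) (𝓡 4) Ψ z W)) :=
      (𝓢.timeOrientation.isFutureDirected_neg_iff _).mpr hP
    have hle' := hA.val_nonpos 𝓢.timeOrientation hnegF
    rw [map_neg] at hle'
    linarith

/-- Transport of future-directedness along an equality of base points (the tangent spaces of a spacetime are
all the model space). [folklore] -/
theorem isFutureDirected_congr_point (𝓢 : Spacetime.{0} 4) {p q : 𝓢.carrier} (h : p = q)
    (v : EuclideanSpace ℝ (Fin 4)) :
    𝓢.timeOrientation.IsFutureDirected (x := p) v ↔ 𝓢.timeOrientation.IsFutureDirected (x := q) v := by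
  subst h; exact Iff.rfl


end Summit.FinalStateConjecture.FinalStateConjecture.Theorems.FutureOrientedOfSeamed.Negative

end
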